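import Mathlib
import HarnessLib
import Summits.ValiantsHypothesis.ValiantsHypothesis.Theorems.LacunarySymmetroidMatrixDescartesCensusSupportNormalForm

/-!
# ValiantsHypothesis / LacunarySymmetroid — crux `MatrixDescartes` (stmt-ValiantsHypothesis-18050, V1),
# line `Cruxes/MatrixDescartes/Lines/osculation_law.lean` («osculation-law»), stub `stub_recursion`:
# THE BASE OF THE K-INDUCTION — ONE AND TWO LETTERS, PROVED DIRECTLY (no peeling)

The recursion behind `stub_recursion` (val-lit-p8 g12's audit/SPEC, val-lit-p4 g13's R3/R4, val-port-3 g1's transfer step)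
inserts letters one at a time and needs the peel inequality in GENERAL POSITION at every node.  The first two levels are NEVER in
general position (val-lit-p7 g13, NOTE-p7g13-18050-GP-density-sizing.md §2: inserting into the zero pencil has `det ≡ 0`; inserting
into a one-exponent pencil meets MONOMIAL eigenvalue branches, along which the bordered log-Hessian vanishes identically, so the
osculation set is infinite).  Hence the induction must START at two letters, with the bases proved directly:

* `card_posRoots_det_affine_le` — `det(C(A) + X·C(B))` has at most `m` distinct positive roots (degree `≤ m`,
  Mathlib `Polynomial.natDegree_det_X_add_C_le`).
* `posRootLawAt_one` — ONE letter: `det(X^d·C(S)) = X^{md}·C(det S)` has no positive root: `PosRootLawAt m 1 0`.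
* `card_posRoots_two_letters_normal`, **`posRootLawAt_two`** — TWO letters: `PosRootLawAt m 2 m`.  On a normal-form support
  `d = (0, δ)`, `δ ≥ 1` (`Census.posRootLawAt_iff_strictMono`), the pencil is `expand δ` of the affine pencil `C(S₀) + X·C(S₁)`
  (`Census.det_pencil_mul_eq_expand`), and `t ↦ t^δ` is a bijection of `(0, ∞)` on distinct positive roots (`Census.card_posRoots_expand`).
* `card_posRoots_mult_expand_le`, **`zmult_two_letters`** — the same in the MULTIPLICITY currency of the peel files:
  `Z₊mult(det(X^{d₀}C(S₀) + X^{d₁}C(S₁))) ≤ m` for any exponents (equal exponents: no positive root at all); `t ↦ t^δ` preserves the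
  multiplicity of a positive root (`X^δ − t₀^δ = (X − t₀)·w` with `w(t₀) > 0`, `geom_sum₂_mul`).

Honest framing: base cases of an OPEN stub's induction; `stub_recursion`, the osculation LAW, `MatrixDescartes` (18050) and `VP ≠ VNP` are
NOT proved.  No definitions, no named facts.
-/

-- `Summit.ValiantsHypothesis.ValiantsHypothesis.…` is the tree's mandated single-conjunct layout (Sub = Summit).
set_option linter.dupNamespace false

noncomputable section

namespace Summit.ValiantsHypothesis.ValiantsHypothesis.Theorems.LacunarySymmetroidMatrixDescartes

open Polynomial Finset
open scoped BigOperators Polynomial Matrix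
open Summit.ValiantsHypothesis.ValiantsHypothesis.Theorems.MatrixDescartes.Negative (PosRootLawAt)

namespace OsculationRecursion

/-! ### The affine pencil `C(A) + X·C(B)` -/

/-- `det(C(A) + X·C(B))` has degree `≤ m`, hence at most `m` roots counted with multiplicity. [folklore] -/
theorem card_roots_det_affine_le {m : ℕ} (A B : Matrix (Fin m) (Fin m) ℝ) :
    Multiset.card (A.map C + (X : ℝ[X]) • B.map C).det.roots ≤ m := by
  have h := Polynomial.natDegree_det_X_add_C_le B A
  rw [Fintype.card_fin] at h
  rw [add_comm]
  exact (card_roots' _).trans h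

/-- `det(C(A) + X·C(B))` has at most `m` distinct positive roots. [folklore] -/
theorem card_posRoots_det_affine_le {m : ℕ} (A B : Matrix (Fin m) (Fin m) ℝ) :
    ((A.map C + (X : ℝ[X]) • B.map C).det.roots.toFinset.filter (fun t => 0 < t)).card ≤ m :=
  calc ((A.map C + (X : ℝ[X]) • B.map C).det.roots.toFinset.filter (fun t => 0 < t)).card
        ≤ (A.map C + (X : ℝ[X]) • B.map C).det.roots.toFinset.card := Finset.card_filter_le _ _
    _ ≤ Multiset.card (A.map C + (X : ℝ[X]) • B.map C).det.roots := Multiset.toFinset_card_le _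
    _ ≤ m := card_roots_det_affine_le A B

/-! ### One letter -/

/-- The one-letter pencil: `det(X^d·C(S)) = X^{md}·C(det S)`. [folklore] -/
theorem det_one_letter {m : ℕ} (d : ℕ) (S : Matrix (Fin m) (Fin m) ℝ) :
    ((X : ℝ[X]) ^ d • S.map C).det = (X : ℝ[X]) ^ (m * d) • Polynomial.C S.det := by
  rw [Matrix.det_smul, Fintype.card_fin, ← pow_mul, smul_eq_mul, mul_comm d m]
  congr 1
  exact (RingHom.map_det (Polynomial.C : ℝ →+* ℝ[X]) S).symm

/-- **One letter**: no positive root — `PosRootLawAt m 1 0`. [folklore] -/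
theorem posRootLawAt_one (m : ℕ) : PosRootLawAt m 1 0 := by
  intro d S _
  rw [Fin.sum_univ_one, det_one_letter, smul_eq_mul, Census.posRoots_X_pow_mul_eq, roots_C]
  simp

/-! ### Two letters, distinct positive roots -/

/-- **Two letters on a normal-form support** `d 0 = 0 < d 1`: at most `m` distinct positive roots. [folklore] -/
theorem card_posRoots_two_letters_normal {m : ℕ} (d : Fin 2 → ℕ) (hd : StrictMono d) (h0 : d 0 = 0)
    (S : Fin 2 → Matrix (Fin m) (Fin m) ℝ) :
    ((∑ l, (X : ℝ[X]) ^ d l • (S l).map C).det.roots.toFinset.filter (fun t => 0 < t)).card ≤ m := by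
  have hδ : 0 < d 1 := by
    have h := hd (show (0 : Fin 2) < 1 from Fin.zero_lt_one)
    rw [h0] at h
    exact h
  have hd' : ∀ l : Fin 2, d l = d 1 * (![0, 1] : Fin 2 → ℕ) l := by
    intro l
    fin_cases l
    · simp [h0]
    · simp
  have hpencil : (∑ l, (X : ℝ[X]) ^ d l • (S l).map C) =
      ∑ l, (X : ℝ[X]) ^ (d 1 * (![0, 1] : Fin 2 → ℕ) l) • (S l).map C :=
    Finset.sum_congr rfl fun l _ => by rw [← hd' l]
  rw [hpencil, Census.det_pencil_mul_eq_expand, Census.card_posRoots_expand _ hδ, Fin.sum_univ_two]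
  simp only [Matrix.cons_val_zero, Matrix.cons_val_one, pow_zero, one_smul, pow_one]
  exact card_posRoots_det_affine_le (S 0) (S 1)

/-- **Two letters**: `PosRootLawAt m 2 m` — every symmetric `m × m` pencil with two letters has at most `m` distinct positive
zeros of its determinant (symmetry is not even used). [folklore] -/
theorem posRootLawAt_two (m : ℕ) : PosRootLawAt m 2 m :=
  (Census.posRootLawAt_iff_strictMono m 1 m).2 fun d hd h0 S _ => card_posRoots_two_letters_normal d hd h0 S

/-! ### Two letters, positive roots WITH MULTIPLICITY (the peel files' currency `posRootsMult`) -/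

/-- A monomial factor does not change the positive roots, with multiplicity. [folklore] -/
theorem card_posRoots_filter_X_pow_mul (k : ℕ) (q : ℝ[X]) :
    Multiset.card (((X : ℝ[X]) ^ k * q).roots.filter (fun t => 0 < t)) =
      Multiset.card (q.roots.filter (fun t => 0 < t)) := by
  by_cases hq : q = 0
  · simp [hq]
  rw [roots_mul (mul_ne_zero (pow_ne_zero _ X_ne_zero) hq), roots_X_pow, Multiset.filter_add,
    Multiset.card_add]
  have h0 : (k • ({0} : Multiset ℝ)).filter (fun t => 0 < t) = 0 :=
    Multiset.filter_eq_nil.2 fun t ht => by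
      have h := Multiset.mem_of_mem_nsmul ht
      rw [Multiset.mem_singleton] at h
      rw [h]; exact lt_irrefl 0
  rw [h0, Multiset.card_zero, zero_add]

/-- `X^δ − C(t₀^δ) = (X − C t₀) · w` with `w = Σ_{i<δ} X^i · C(t₀^{δ−1−i})`, and `w(t) > 0` for `t, t₀ > 0`. [folklore] -/
theorem X_pow_sub_C_pow_eq (δ : ℕ) (t₀ : ℝ) :
    (X : ℝ[X]) ^ δ - Polynomial.C (t₀ ^ δ) =
      (X - Polynomial.C t₀) * ∑ i ∈ Finset.range δ, (X : ℝ[X]) ^ i * Polynomial.C t₀ ^ (δ - 1 - i) := by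
  rw [mul_comm, geom_sum₂_mul, ← C_pow]

/-- **`t ↦ t^δ` preserves the multiplicity of a positive root**: for `t₀ > 0`,
`rootMultiplicity t₀ (expand δ p) = rootMultiplicity (t₀^δ) p` (`δ ≥ 1`, `p ≠ 0`). [folklore] -/
theorem rootMultiplicity_expand_of_pos {δ : ℕ} (hδ : 0 < δ) {p : ℝ[X]} (hp : p ≠ 0) {t₀ : ℝ} (ht₀ : 0 < t₀) :
    (expand ℝ δ p).rootMultiplicity t₀ = p.rootMultiplicity (t₀ ^ δ) := by
  classical
  set u : ℝ := t₀ ^ δ with hu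
  obtain ⟨r, hpr, hndvd⟩ := exists_eq_pow_rootMultiplicity_mul_and_not_dvd p hp u
  have hr0 : r ≠ 0 := by
    rintro rfl
    rw [mul_zero] at hpr
    exact hp hpr
  have hru : r.eval u ≠ 0 := fun h => hndvd (dvd_iff_isRoot.2 h)
  set w : ℝ[X] := ∑ i ∈ Finset.range δ, (X : ℝ[X]) ^ i * Polynomial.C t₀ ^ (δ - 1 - i) with hw
  have hexp : expand ℝ δ p = (X - Polynomial.C t₀) ^ p.rootMultiplicity u * (w ^ p.rootMultiplicity u * expand ℝ δ r) := by
    conv_lhs => rw [hpr]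
    rw [map_mul, map_pow, map_sub, expand_X, expand_C, hu, X_pow_sub_C_pow_eq, mul_pow, mul_assoc]
  -- the cofactor does not vanish at `t₀`
  have hw_pos : 0 < w.eval t₀ := by
    rw [hw, eval_finsetSum]
    refine Finset.sum_pos (fun i _ => ?_) (Finset.nonempty_range_iff.2 hδ.ne')
    rw [eval_mul, eval_pow, eval_X, eval_pow, eval_C]
    positivity
  have hcof : ¬ (w ^ p.rootMultiplicity u * expand ℝ δ r).IsRoot t₀ := by
    rw [IsRoot, eval_mul, eval_pow, expand_eval]
    exact mul_ne_zero (pow_ne_zero _ hw_pos.ne') hru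
  have hw0 : w ≠ 0 := fun h => by
    rw [h, eval_zero] at hw_pos
    exact lt_irrefl _ hw_pos
  have hcof0 : w ^ p.rootMultiplicity u * expand ℝ δ r ≠ 0 :=
    mul_ne_zero (pow_ne_zero _ hw0) fun h => hr0 ((expand_eq_zero hδ).1 h)
  have hne : (X - Polynomial.C t₀) ^ p.rootMultiplicity u * (w ^ p.rootMultiplicity u * expand ℝ δ r) ≠ 0 :=
    mul_ne_zero (pow_ne_zero _ (X_sub_C_ne_zero t₀)) hcof0
  rw [hexp, rootMultiplicity_mul hne, rootMultiplicity_X_sub_C_pow, rootMultiplicity_eq_zero hcof, add_zero]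

/-- **Positive roots with multiplicity under `expand`**: `Z₊mult(expand δ p) ≤ #roots(p)` (`δ ≥ 1`). [folklore] -/
theorem card_posRoots_mult_expand_le {δ : ℕ} (hδ : 0 < δ) (p : ℝ[X]) :
    Multiset.card ((expand ℝ δ p).roots.filter (fun t => 0 < t)) ≤ Multiset.card p.roots := by
  classical
  by_cases hp : p = 0
  · simp [hp]
  have hep : expand ℝ δ p ≠ 0 := fun h => hp ((expand_eq_zero hδ).1 h)
  set M := (expand ℝ δ p).roots.filter (fun t => 0 < t) with hM
  have hMpos : ∀ t ∈ M, 0 < t := fun t ht => (Multiset.mem_filter.1 ht).2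
  have hle : M.map (fun t => t ^ δ) ≤ p.roots := by
    rw [Multiset.le_iff_count]
    intro u
    rw [Multiset.count_map]
    by_cases hex : ∃ t ∈ M, u = t ^ δ
    · obtain ⟨t₀, ht₀M, rfl⟩ := hex
      have ht₀ : 0 < t₀ := hMpos t₀ ht₀M
      -- the fibre over `t₀ ^ δ` inside `M` is exactly the copies of `t₀`
      have hfib : M.filter (fun a => t₀ ^ δ = a ^ δ) = M.filter (· = t₀) := by
        refine Multiset.filter_congr fun a ha => ?_
        exact ⟨fun h => (pow_left_inj₀ (hMpos a ha).le ht₀.le hδ.ne').1 h.symm, fun h => by rw [h]⟩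
      rw [hfib, Multiset.filter_eq', Multiset.card_replicate, hM, Multiset.count_filter_of_pos ht₀, count_roots,
        count_roots, rootMultiplicity_expand_of_pos hδ hp ht₀]
    · have h0 : M.filter (fun a => u = a ^ δ) = 0 :=
        Multiset.filter_eq_nil.2 fun a ha h => hex ⟨a, ha, h⟩
      rw [h0, Multiset.card_zero]
      exact Nat.zero_le _
  calc Multiset.card M = Multiset.card (M.map fun t => t ^ δ) := (Multiset.card_map _ _).symm
    _ ≤ Multiset.card p.roots := Multiset.card_le_card hle

/-- **Two letters, with multiplicity**: `Z₊mult(det(X^{d₀}·C(S₀) + X^{d₁}·C(S₁))) ≤ m` for `d₀ ≤ d₁`. [folklore] -/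
theorem zmult_two_letters_of_le {m : ℕ} {d₀ d₁ : ℕ} (hd : d₀ ≤ d₁) (S₀ S₁ : Matrix (Fin m) (Fin m) ℝ) :
    Multiset.card (((X : ℝ[X]) ^ d₀ • S₀.map C + (X : ℝ[X]) ^ d₁ • S₁.map C).det.roots.filter (fun t => 0 < t)) ≤ m := by
  obtain ⟨δ, rfl⟩ := Nat.exists_eq_add_of_le hd
  have hfac : (X : ℝ[X]) ^ d₀ • S₀.map C + (X : ℝ[X]) ^ (d₀ + δ) • S₁.map C =
      (X : ℝ[X]) ^ d₀ • (S₀.map C + (X : ℝ[X]) ^ δ • S₁.map C) := by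
    rw [smul_add, pow_add, mul_smul]
  rw [hfac, Matrix.det_smul, Fintype.card_fin, ← pow_mul, card_posRoots_filter_X_pow_mul]
  rcases Nat.eq_zero_or_pos δ with rfl | hδ
  · -- equal exponents: `det(C(S₀) + C(S₁)) = C(det(S₀ + S₁))` has no roots
    have hC : (S₀.map (Polynomial.C : ℝ →+* ℝ[X]) + S₁.map (Polynomial.C : ℝ →+* ℝ[X])).det
        = Polynomial.C (S₀ + S₁).det := by
      rw [← Matrix.map_add (Polynomial.C : ℝ → ℝ[X]) (fun a b => Polynomial.C_add) S₀ S₁, RingHom.map_det,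
        RingHom.mapMatrix_apply]
    rw [pow_zero, one_smul, hC, roots_C]
    simp
  · -- `S₀.map C + X^δ • S₁.map C` is `expand δ` of the affine pencil
    have hpencil : S₀.map C + (X : ℝ[X]) ^ δ • S₁.map C =
        ∑ l, (X : ℝ[X]) ^ (δ * (![0, 1] : Fin 2 → ℕ) l) • ((![S₀, S₁] : Fin 2 → Matrix (Fin m) (Fin m) ℝ) l).map C := by
      rw [Fin.sum_univ_two]
      simp only [Matrix.cons_val_zero, Matrix.cons_val_one, mul_zero, pow_zero, one_smul, mul_one]
    have haff : (∑ l, (X : ℝ[X]) ^ ((![0, 1] : Fin 2 → ℕ) l) • ((![S₀, S₁] : Fin 2 → Matrix (Fin m) (Fin m) ℝ) l).map C)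
        = S₀.map C + (X : ℝ[X]) • S₁.map C := by
      rw [Fin.sum_univ_two]
      simp only [Matrix.cons_val_zero, Matrix.cons_val_one, pow_zero, one_smul, pow_one]
    rw [hpencil, Census.det_pencil_mul_eq_expand, haff]
    exact (card_posRoots_mult_expand_le hδ _).trans (card_roots_det_affine_le S₀ S₁)

/-- **Two letters, with multiplicity, any exponents** (the `Fin 2`-family form of the line's pencils):
`Z₊mult(det Σ_{l<2} X^{d l}·C(S l)) ≤ m`. [folklore] -/
theorem zmult_two_letters {m : ℕ} (d : Fin 2 → ℕ) (S : Fin 2 → Matrix (Fin m) (Fin m) ℝ) :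
    Multiset.card ((∑ l, (X : ℝ[X]) ^ d l • (S l).map C).det.roots.filter (fun t => 0 < t)) ≤ m := by
  rw [Fin.sum_univ_two]
  rcases le_total (d 0) (d 1) with h | h
  · exact zmult_two_letters_of_le h (S 0) (S 1)
  · rw [add_comm]
    exact zmult_two_letters_of_le h (S 1) (S 0)

end OsculationRecursion

end Summit.ValiantsHypothesis.ValiantsHypothesis.Theorems.LacunarySymmetroidMatrixDescartes

end
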